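import Summits.AtomisticToContinuum.HydrodynamicLimit.Theorems.OneFlightGossipEngineCollisionActivityTailsActivityDomination
import Summits.AtomisticToContinuum.HydrodynamicLimit.Theorems.OneFlightGossipEngineCollisionActivityTailsNearFieldKineticTailsPathwise
import Summits.AtomisticToContinuum.HydrodynamicLimit.Theorems.OneFlightGossipEngineCollisionActivityTailsEndpointTails
import Literature.Analysis.FluidPDE.EmpiricalCollisionMeasureMeasurableLabels
import HarnessLib

/-!
# `CollisionActivityTails` (stmt-AtomisticToContinuum-13734), line `SketchK1`: measurability and window additivity of the
crux's window activity

Helper file (`--supports stmt-AtomisticToContinuum-13734`) for the crux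
`Summit.AtomisticToContinuum.HydrodynamicLimit.Theses.OneFlightGossipEngine.CollisionActivityTails` (shared, with a
byte-identical body, by `…Theses.TwoClocks.CollisionActivityTails`), skeleton line `SketchK1`
(`Cruxes/CollisionActivityTails/Lines/SketchK1.lean`). File 1 of 2 (the second, `…CollisionActivityTailsOneWindow`, proves
that ONE good window scale per level and accuracy suffices for the crux). Infrastructure about the crux's OWN functional, the
window activity `a_i = act Φ τ s i = (σ/τ) Σ_{collisions of i, times in (s, s + w]} |v_i⁺ − v_i⁻|`, `w = τ (N+1)^{-1/3}`
(vocabulary of the landed `…CollisionActivityTailsActivityDomination`):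

* §1 **Measurability.** On the collisions of an orbit the crux's summand `𝟙{c.fst = i} |v_fst⁺ − v_fst⁻|` is a
  CONTINUOUS function of the ordered labels and of the collision mark `(t, x, ω, v⁻, v_*⁻)`, namely
  `𝟙{fst = i} |⟪v⁻ − v_*⁻, ω⟫|` (`impulse_eq_abs_inner_mark`: the impulse is the normal component of the relative
  velocity, and the elastic reflection only flips its sign); hence `act Φ τ s i` is a.e.-measurable for every law
  carried by the good set of the flow, in particular for the local Gibbs law (`aemeasurable_act`,
  `aemeasurable_sum_tailFn_act`; engine: `HardSphereFlow.aemeasurable_of_eqOn_collisionSum_labels_torus`,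
  `0 < σ < 1/2`). This is what any splitting `E[Σ …] = Σ E[…]` of the crux's expectation needs (the crux integrand is an
  inner `lintegral`), and what gives the activity a LAW (the abstract shape lemmas of `Negative/ShapeSeparation` speak of
  laws on `ℝ`).
* §2 **Window additivity.** The un-normalised impulse of `i` (`impulse`) is additive and monotone over adjacent windows on
  the good set (finitely many collision times in bounded windows, `collisionPairSum_union`), so
  `act Φ ((K+1)τ₁) s i = (K+1)⁻¹ Σ_{k ≤ K} act Φ τ₁ (s + k w₁) i` (`act_succ_mul_eq_avg`, `w₁ = window τ₁ N`) and
  `act Φ τ s i ≤ 2 · act Φ ((K+1)τ₁) s i` for `K τ₁ ≤ τ ≤ (K+1) τ₁`, `K ≥ 1` (`act_le_two_mul`).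

References: I. Gallagher, L. Saint-Raymond, B. Texier, *From Newton to Boltzmann* (2013), §4.1 (collision marks of the
hard-sphere flow; the elastic law (1.1.2)–(1.1.3)); C. Cercignani, R. Illner, M. Pulvirenti, *The Mathematical Theory of
Dilute Gases* (1994), §4.2, App. 4.A (the flow, sums along it). The lemmas themselves are elementary and recorded here.
-/

noncomputable section

open MeasureTheory Set Filter Topology
open scoped ENNReal InnerProductSpace

namespace Summit.AtomisticToContinuum.HydrodynamicLimit.Theorems.CollisionActivityTailsWindowAlgebra

open Literature.MathematicalPhysics.KineticTheory Literature.Analysis.FluidPDE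
open Summit.AtomisticToContinuum.HydrodynamicLimit.Theorems.CollisionActivityTailsActivityDomination
open Summit.AtomisticToContinuum.HydrodynamicLimit.Theorems.CollisionActivityTailsNearFieldKineticTails (tailFn
  tailFn_nonneg measurable_tailFn)

variable {σ : ℝ} {N : ℕ}

/-! ## §1 Measurability of the window activity in the initial datum -/

/-- The crux's summand `𝟙{c.fst = i} |v_fst⁺ − v_fst⁻|` of a collision record. -/
def ownImpulseRec (i : Fin (N + 1)) (c : HardSphereCollisionRecord (Fin 3) T3 (N + 1)) : ℝ :=
  if c.fst = i then ‖c.postVel.1 - c.preVel.1‖ else 0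

/-- The same summand as a function of the ordered labels and of the collision MARK `(t, x, ω, v⁻, v_*⁻)`:
`𝟙{fst = i} |⟪v⁻ − v_*⁻, ω⟫|` (continuous in the mark at fixed labels). -/
def ownImpulseMark (i k : Fin (N + 1)) (_l : Fin (N + 1)) (m : ℝ × T3 × V3 × V3 × V3) : ℝ :=
  if k = i then |⟪m.2.2.2.1 - m.2.2.2.2, m.2.2.1⟫_ℝ| else 0

/-- The mark form of the summand is continuous in the mark. -/
theorem continuous_ownImpulseMark (i k l : Fin (N + 1)) : Continuous (ownImpulseMark (N := N) i k l) := by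
  unfold ownImpulseMark
  split_ifs
  · exact (((continuous_fst.comp (continuous_snd.comp (continuous_snd.comp continuous_snd))).sub
      (continuous_snd.comp (continuous_snd.comp (continuous_snd.comp continuous_snd)))).inner
      (continuous_fst.comp (continuous_snd.comp continuous_snd))).abs
  · exact continuous_const

/-- The elastic reflection flips the sign of the normal component of the relative velocity. -/
theorem inner_reflectVel_fst_sub_snd {E : Type*} [NormedAddCommGroup E] [InnerProductSpace ℝ E] (n : E)
    (p : E × E) : ⟪(reflectVel n p).1 - (reflectVel n p).2, n⟫_ℝ = -⟪p.1 - p.2, n⟫_ℝ := by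
  have h : (reflectVel n p).1 - (reflectVel n p).2 = (p.1 - p.2) - (2 * (⟪p.1 - p.2, n⟫_ℝ / ‖n‖ ^ 2)) • n := by
    simp only [reflectVel]
    rw [two_mul, add_smul]
    abel
  rw [h, inner_sub_left, inner_smul_left, real_inner_self_eq_norm_sq]
  by_cases hn : n = 0
  · simp [hn]
  · have hn' : ‖n‖ ≠ 0 := norm_ne_zero_iff.2 hn
    simp only [RCLike.conj_to_real]
    field_simp
    ring

/-- The velocity jump of the first partner under the reflection law is the normal component of the relative velocity:
`|v⁺ − v⁻| = |⟪v − v_*, n⟫| / |n|` (`n ≠ 0`). -/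
theorem norm_fst_sub_reflectVel_fst {E : Type*} [NormedAddCommGroup E] [InnerProductSpace ℝ E] {n : E}
    (hn : n ≠ 0) (v w : E) : ‖v - (reflectVel n (v, w)).1‖ = |⟪v - w, n⟫_ℝ| / ‖n‖ := by
  have h : v - (reflectVel n (v, w)).1 = (⟪v - w, n⟫_ℝ / ‖n‖ ^ 2) • n := by
    simp only [reflectVel]
    abel
  have hn' : ‖n‖ ≠ 0 := norm_ne_zero_iff.2 hn
  rw [h, norm_smul, Real.norm_eq_abs, abs_div, abs_of_nonneg (sq_nonneg ‖n‖)]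
  field_simp

/-- **The impulse read off the mark.** For a record read off a configuration at a pair at distance `ε > 0`, the crux's
summand `|v_fst⁺ − v_fst⁻|` equals `|⟪v_fst⁻ − v_snd⁻, ω⟫|` with `ω = ε⁻¹ (x_fst − x_snd)` the record's impact vector. -/
theorem impulse_eq_abs_inner_mark {d : Type*} [Fintype d] {X : Type*} {n : ℕ} (G : Geometry d X) {ε : ℝ}
    (hε : 0 < ε) (z : Config n d X) (t : ℝ) (k l : Fin n) (hkl : ‖G.sepVec (z k).1 (z l).1‖ = ε) :
    ‖(HardSphereCollisionRecord.ofConfig G ε z t k l).postVel.1 -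
        (HardSphereCollisionRecord.ofConfig G ε z t k l).preVel.1‖ =
      |⟪(HardSphereCollisionRecord.ofConfig G ε z t k l).preVel.1 -
          (HardSphereCollisionRecord.ofConfig G ε z t k l).preVel.2,
        (HardSphereCollisionRecord.ofConfig G ε z t k l).impactVec⟫_ℝ| := by
  have hn : G.sepVec (z k).1 (z l).1 ≠ 0 := by
    intro h0
    rw [h0, norm_zero] at hkl
    exact hε.ne' hkl.symm
  simp only [HardSphereCollisionRecord.ofConfig_postVel, HardSphereCollisionRecord.ofConfig_preVel,
    HardSphereCollisionRecord.ofConfig_impactVec]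
  rw [inner_smul_right, inner_reflectVel_fst_sub_snd, norm_fst_sub_reflectVel_fst hn, hkl, abs_mul, abs_neg,
    abs_inv, abs_of_pos hε, div_eq_inv_mul]

/-- On the good set, the collision sum of the crux's summand equals the collision sum of its MARK form: along the orbit
every record is read off a configuration of the hard-sphere domain at a contact pair (`‖x_k − x_l‖ = ε`). -/
theorem collisionSum_ownImpulseRec_eq_mark (hσ : 0 < σ) (Φ : Flow σ N) (S : Set ℝ) (i : Fin (N + 1))
    {z : Cfg N} (hz : z ∈ Φ.good) :
    Φ.collisionSum S (ownImpulseRec i) z = Φ.collisionSum S (fun c => ownImpulseMark i c.fst c.snd c.mark) z := by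
  rw [HardSphereFlow.collisionSum_eq, HardSphereFlow.collisionSum_eq]
  refine collisionSum_congr fun t _ p hp => ?_
  have hdist := ((mem_contactPairs_iff_of_mem ((Φ.isTrajectory z hz).mem t)).1 hp).2
  simp only [HardSphereCollisionRecord.ofConfig_fst, HardSphereCollisionRecord.mark_def, ownImpulseMark,
    ownImpulseRec]
  split_ifs
  · exact impulse_eq_abs_inner_mark _ (hsDiameter_pos hσ N) _ t p.1 p.2 hdist
  · rfl

/-- On the good set the window activity is `(σ/τ) ×` the collision sum of the mark form of its summand. -/
theorem act_eq_collisionSum_mark (hσ : 0 < σ) (Φ : Flow σ N) (τ s : ℝ) (i : Fin (N + 1)) {z : Cfg N}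
    (hz : z ∈ Φ.good) :
    act Φ τ s i z =
      σ / τ * Φ.collisionSum (Ioc s (s + window τ N)) (fun c => ownImpulseMark i c.fst c.snd c.mark) z := by
  rw [← collisionSum_ownImpulseRec_eq_mark hσ Φ _ i hz]
  rfl

/-- **The window activity is a.e.-measurable** in the initial datum, for every law carried by the good set of the flow
(`0 < σ < 1/2`, so that the torus geometry is regular at the diameter `σ (N+1)^{-1/3} ≤ σ`). -/
theorem aemeasurable_act (hσ : 0 < σ) (hσ2 : σ < 2⁻¹) (Φ : Flow σ N) (τ s : ℝ) (i : Fin (N + 1))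
    {μ : Measure (Cfg N)} (hμ : ∀ᵐ z ∂μ, z ∈ Φ.good) : AEMeasurable (act Φ τ s i) μ := by
  have hε : hsDiameter σ N < 2⁻¹ := (hsDiameter_le hσ.le N).trans_lt hσ2
  have h : AEMeasurable (fun z => Φ.collisionSum (Ioc s (s + window τ N)) (ownImpulseRec i) z) μ :=
    Φ.aemeasurable_of_eqOn_collisionSum_labels_torus hε (fun k l => continuous_ownImpulseMark i k l)
      s (s + window τ N) (fun z hz => collisionSum_ownImpulseRec_eq_mark hσ Φ _ i hz) hμ
  exact h.const_mul (σ / τ)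

/-- **The crux's tail sum is a.e.-measurable** under the local Gibbs law: `z ↦ Σ_i 𝟙{V < a_i(z)} a_i(z)`
(`0 < σ < 1/2`, all profiles, all `N`, flows, windows, starts and levels). -/
theorem aemeasurable_sum_tailFn_act (hσ : 0 < σ) (hσ2 : σ < 2⁻¹) (a₀ θ₀ : T3 → ℝ) (u₀ : T3 → V3) (N : ℕ)
    (Φ : Flow σ N) (τ s V : ℝ) :
    AEMeasurable (fun z => ∑ i : Fin (N + 1), tailFn V (act Φ τ s i z)) (localGibbsLaw σ a₀ u₀ θ₀ N Φ) :=
  Finset.aemeasurable_fun_sum _ fun i _ =>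
    (measurable_tailFn V).comp_aemeasurable
      (aemeasurable_act hσ hσ2 Φ τ s i (CollisionActivityTailsEndpointTails.ae_mem_good_localGibbsLaw σ a₀ θ₀ u₀ N Φ))

/-- **ACTIVITY MEASURABILITY** (registered helper sub-goal `stub_actMeasurable` of line `SketchK1`): for
`0 < σ < 1/2`, all profiles, every `N`, flow, window length, start and level, the crux's tail sum
`z ↦ Σ_i 𝟙{V < a_i(z)} a_i(z)` is a.e.-measurable for the local Gibbs law. -/
def ActMeasurable : Prop :=
  ∀ (σ : ℝ), 0 < σ → σ < 2⁻¹ → ∀ (a₀ θ₀ : T3 → ℝ) (u₀ : T3 → V3) (N : ℕ) (Φ : Flow σ N) (τ s V : ℝ),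
    AEMeasurable (fun z => ∑ i : Fin (N + 1), tailFn V (act Φ τ s i z)) (localGibbsLaw σ a₀ u₀ θ₀ N Φ)

/-- **STUB `stub_actMeasurable` (line `SketchK1`)**: the crux's tail sum is a.e.-measurable under the local Gibbs law
(`aemeasurable_sum_tailFn_act`). -/
theorem stub_actMeasurable : ActMeasurable := fun _σ hσ hσ2 a₀ θ₀ u₀ N Φ τ s V =>
  aemeasurable_sum_tailFn_act hσ hσ2 a₀ θ₀ u₀ N Φ τ s V

/-! ## §2 Window additivity of the activity on the good set -/

/-- The un-normalised impulse of `i` over the times in `S`: `Σ_{collisions of i, times in S} |v_i⁺ − v_i⁻|`. -/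
def impulse (Φ : Flow σ N) (S : Set ℝ) (i : Fin (N + 1)) (z : Cfg N) : ℝ :=
  Φ.collisionSum S (ownImpulseRec i) z

/-- The activity is `(σ/τ) ×` the impulse over the window `(s, s + w]` (definitional). -/
theorem act_eq_impulse (Φ : Flow σ N) (τ s : ℝ) (i : Fin (N + 1)) (z : Cfg N) :
    act Φ τ s i z = σ / τ * impulse Φ (Ioc s (s + window τ N)) i z := rfl

/-- The impulse is nonnegative. -/
theorem impulse_nonneg (Φ : Flow σ N) (S : Set ℝ) (i : Fin (N + 1)) (z : Cfg N) : 0 ≤ impulse Φ S i z := by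
  unfold impulse HardSphereFlow.collisionSum Literature.Analysis.FluidPDE.collisionSum
    Literature.Analysis.FluidPDE.collisionPairSum
  refine finsum_nonneg fun t => finsum_nonneg fun _ => Finset.sum_nonneg fun p _ => ?_
  beta_reduce
  unfold ownImpulseRec
  split_ifs <;> positivity

/-- The activity is nonnegative (`σ, τ ≥ 0`). -/
theorem act_nonneg (hσ : 0 ≤ σ) (Φ : Flow σ N) {τ : ℝ} (hτ : 0 ≤ τ) (s : ℝ) (i : Fin (N + 1)) (z : Cfg N) :
    0 ≤ act Φ τ s i z :=
  mul_nonneg (div_nonneg hσ hτ) (impulse_nonneg Φ _ i z)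

/-- **Additivity over adjacent windows** on the good set (finitely many collision times in bounded windows). -/
theorem impulse_Ioc_add (Φ : Flow σ N) {z : Cfg N} (hz : z ∈ Φ.good) {a b c : ℝ} (hab : a ≤ b) (hbc : b ≤ c)
    (i : Fin (N + 1)) :
    impulse Φ (Ioc a c) i z = impulse Φ (Ioc a b) i z + impulse Φ (Ioc b c) i z := by
  unfold impulse
  rw [HardSphereFlow.collisionSum_eq, HardSphereFlow.collisionSum_eq, HardSphereFlow.collisionSum_eq,
    Literature.Analysis.FluidPDE.collisionSum_eq_collisionPairSum,
    Literature.Analysis.FluidPDE.collisionSum_eq_collisionPairSum,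
    Literature.Analysis.FluidPDE.collisionSum_eq_collisionPairSum, ← Ioc_union_Ioc_eq_Ioc hab hbc,
    collisionPairSum_union (Φ.finite_collisionTimes_inter hz Ioc_subset_Icc_self)
      (Φ.finite_collisionTimes_inter hz Ioc_subset_Icc_self) (Ioc_disjoint_Ioc_of_le le_rfl)]

/-- Monotonicity of the impulse in the right endpoint of the window (good set). -/
theorem impulse_Ioc_mono (Φ : Flow σ N) {z : Cfg N} (hz : z ∈ Φ.good) {a b c : ℝ} (hab : a ≤ b) (hbc : b ≤ c)
    (i : Fin (N + 1)) : impulse Φ (Ioc a b) i z ≤ impulse Φ (Ioc a c) i z := by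
  rw [impulse_Ioc_add Φ hz hab hbc i]
  linarith [impulse_nonneg Φ (Ioc b c) i z]

/-- The window is additive in `τ`. -/
theorem window_add (τ₁ τ₂ : ℝ) (N : ℕ) : window (τ₁ + τ₂) N = window τ₁ N + window τ₂ N := by
  unfold window
  ring

/-- The window is linear in `τ`. -/
theorem window_mul (c τ : ℝ) (N : ℕ) : window (c * τ) N = c * window τ N := by
  unfold window
  ring

/-- The window is monotone in `τ`. -/
theorem window_le_window {τ τ' : ℝ} (h : τ ≤ τ') (N : ℕ) : window τ N ≤ window τ' N := by
  unfold window
  exact mul_le_mul_of_nonneg_right h (Real.rpow_pos_of_pos (by positivity) _).le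

/-- The impulse over `(s, s + (K+1) w]` is the sum of the impulses over the `K + 1` adjacent windows of length `w ≥ 0`. -/
theorem impulse_Ioc_eq_sum (Φ : Flow σ N) {z : Cfg N} (hz : z ∈ Φ.good) {w : ℝ} (hw : 0 ≤ w) (s : ℝ)
    (i : Fin (N + 1)) (K : ℕ) :
    impulse Φ (Ioc s (s + ((K : ℝ) + 1) * w)) i z =
      ∑ k ∈ Finset.range (K + 1), impulse Φ (Ioc (s + k * w) (s + ((k : ℝ) + 1) * w)) i z := by
  induction K with
  | zero => simp
  | succ K ih =>
    rw [Finset.sum_range_succ, ← ih, impulse_Ioc_add Φ hz (b := s + ((K : ℝ) + 1) * w)]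
    · push_cast
      ring_nf
    · nlinarith
    · push_cast
      nlinarith

/-- **The activity over `K + 1` windows is the average of the `K + 1` adjacent one-window activities** (good set):
`act Φ ((K+1) τ₁) s i = (K+1)⁻¹ Σ_{k ≤ K} act Φ τ₁ (s + k w₁) i`, `w₁ = window τ₁ N`. -/
theorem act_succ_mul_eq_avg (Φ : Flow σ N) {z : Cfg N} (hz : z ∈ Φ.good) {τ₁ : ℝ} (hτ₁ : 0 < τ₁) (s : ℝ)
    (i : Fin (N + 1)) (K : ℕ) :
    act Φ (((K : ℝ) + 1) * τ₁) s i z =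
      ((K : ℝ) + 1)⁻¹ * ∑ k ∈ Finset.range (K + 1), act Φ τ₁ (s + k * window τ₁ N) i z := by
  have hw : 0 ≤ window τ₁ N := (window_pos hτ₁ N).le
  rw [act_eq_impulse, window_mul, impulse_Ioc_eq_sum Φ hz hw s i K, Finset.mul_sum, Finset.mul_sum]
  refine Finset.sum_congr rfl fun k _ => ?_
  rw [act_eq_impulse]
  have hK : (K : ℝ) + 1 ≠ 0 := by positivity
  have h1 : s + ((k : ℝ) + 1) * window τ₁ N = s + k * window τ₁ N + window τ₁ N := by ring
  rw [h1]
  field_simp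

/-- **Intermediate windows.** For `K τ₁ ≤ τ ≤ (K+1) τ₁` with `K ≥ 1` (good set):
`act Φ τ s i ≤ 2 · act Φ ((K+1) τ₁) s i` — the impulse is monotone in the window and `(K+1) τ₁ ≤ 2 τ`. -/
theorem act_le_two_mul (hσ : 0 ≤ σ) (Φ : Flow σ N) {z : Cfg N} (hz : z ∈ Φ.good) {τ₁ τ : ℝ} (hτ₁ : 0 < τ₁)
    {K : ℕ} (hK : 1 ≤ K) (hKτ : (K : ℝ) * τ₁ ≤ τ) (hτK : τ ≤ ((K : ℝ) + 1) * τ₁) (s : ℝ) (i : Fin (N + 1)) :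
    act Φ τ s i z ≤ 2 * act Φ (((K : ℝ) + 1) * τ₁) s i z := by
  have hK1 : (1 : ℝ) ≤ K := by exact_mod_cast hK
  have hτ : 0 < τ := lt_of_lt_of_le (by positivity) hKτ
  have hKτ₁ : 0 < ((K : ℝ) + 1) * τ₁ := by positivity
  rw [act_eq_impulse, act_eq_impulse]
  set I := impulse Φ (Ioc s (s + window τ N)) i z with hI
  set J := impulse Φ (Ioc s (s + window (((K : ℝ) + 1) * τ₁) N)) i z with hJ
  have hIJ : I ≤ J :=
    impulse_Ioc_mono Φ hz (by linarith [(window_pos hτ N).le]) (by linarith [window_le_window hτK N]) i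
  have hJ0 : 0 ≤ J := impulse_nonneg Φ _ i z
  have hkey : ((K : ℝ) + 1) * τ₁ / 2 ≤ τ := by nlinarith
  have hpos : 0 < ((K : ℝ) + 1) * τ₁ / 2 := by positivity
  calc σ / τ * I ≤ σ / τ * J := mul_le_mul_of_nonneg_left hIJ (div_nonneg hσ hτ.le)
    _ ≤ σ / (((K : ℝ) + 1) * τ₁ / 2) * J :=
        mul_le_mul_of_nonneg_right (div_le_div_of_nonneg_left hσ hpos hkey) hJ0
    _ = 2 * (σ / (((K : ℝ) + 1) * τ₁) * J) := by
        rw [div_div_eq_mul_div]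
        ring

end Summit.AtomisticToContinuum.HydrodynamicLimit.Theorems.CollisionActivityTailsWindowAlgebra

end
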